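import Mathlib
import Summits.KontsevichZagierPeriods.KontsevichZagierPeriods.Theses.TorsionLogs
import Summits.KontsevichZagierPeriods.KontsevichZagierPeriods.Theorems.HyperbolicBlochOffTetraSectorKernelRungZeroLogRelations

/-!
# Line `NeronDuplication` on crux `TorsionLogs.NeronTorsionFlex` (stmt-KontsevichZagierPeriods-13806)

Skeleton (G1 next-rung filing, seed stmt-17981 `NeronTorsionPrimitiveChain`):

* `stub_neronDuplicationChain` — the RUNG (load-bearing, XL): the Néron duplication formula as an
  explicit Kontsevich–Zagier chain for an ARBITRARY real point `P` of the identity component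
  (torsion hypothesis of the floor dropped; carrier pinned by `B ^ c = f(x_P)² / D³`).
* `stub_flexTorsionProduct` — support (M): the dimension-2 product shadow `3•[rU] − 2•[rP]` of
  `u_P = ω₁/3` on the flex curve (translation by `P` in the `x`-variable only; cf. the closed
  support `TorsionLogs.OneThirdPeriod`).
* `NeronTorsionFlex_of` — PROVED composition: at the flex (`2P = −P`, so `x_{2P} = x_P` is the
  identity `16·ψ₃(x_P) = 0`), `−3·(rung) + 4·(product) + 3·(interval-log relation
  c•[log B] − [log(f(x_P)²/125)])` is `36•[rI] + [rP] − 3•[rL]`.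
-/

namespace Summit.KontsevichZagierPeriods.KontsevichZagierPeriods.Cruxes.NeronTorsionFlex.NeronDuplication

open Literature.NumberTheory.Transcendental
open Summit.KontsevichZagierPeriods.HyperbolicBloch.OffTetraSectorKernel (interval_log_relation_mem_relations)


/-- The RUNG (crux of the line, XL): Néron duplication chain for arbitrary real points of the identity
component; verbatim `Sketch.NeronDuplicationChain`. -/
def NeronDuplicationChain : Prop :=
  ∀ (g₂ g₃ e₁ xP xR : ℝ) (f : ℝ → ℝ),
    (∀ x, f x = 4 * x ^ 3 - g₂ * x - g₃) → g₂ ^ 3 - 27 * g₃ ^ 2 ≠ 0 → f e₁ = 0 → 0 < e₁ →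
    (∀ x, e₁ < x → 0 < f x) → e₁ < xP →
    xR = (12 * xP ^ 2 - g₂) ^ 2 / (16 * f xP) - 2 * xP → e₁ < xR →
    ∀ (rI rJ rU rP : KZ.IntegralRep 2),
      rI.domain = {z | e₁ < z 1 ∧ z 1 < z 0 ∧ z 0 < xP} →
      Set.EqOn rI.integrand (fun z => z 1 / (Real.sqrt (f (z 1)) * Real.sqrt (f (z 0)))) rI.domain →
      rJ.domain = {z | e₁ < z 1 ∧ z 1 < z 0 ∧ z 0 < xR} →
      Set.EqOn rJ.integrand (fun z => z 1 / (Real.sqrt (f (z 1)) * Real.sqrt (f (z 0)))) rJ.domain →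
      rU.domain = {z | xP < z 0 ∧ e₁ < z 1} →
      Set.EqOn rU.integrand
        (fun z => (Real.sqrt (f (z 0)))⁻¹ * ((g₂ * z 1 + 2 * g₃) / (2 * (z 1) ^ 2 * Real.sqrt (f (z 1))))) rU.domain →
      rP.domain = {z | e₁ < z 0 ∧ e₁ < z 1} →
      Set.EqOn rP.integrand
        (fun z => (Real.sqrt (f (z 0)))⁻¹ * ((g₂ * z 1 + 2 * g₃) / (2 * (z 1) ^ 2 * Real.sqrt (f (z 1))))) rP.domain →
      ∃ (c : ℤ) (B : ℝ) (rB : KZ.IntegralRep 1), 1 < B ∧ IsAlgebraic ℚ B ∧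
        B ^ c = (f xP) ^ 2 / (3 * e₁ ^ 2 - g₂ / 4) ^ 3 ∧
        rB.domain = {t | 1 < t 0 ∧ t 0 < B} ∧ Set.EqOn rB.integrand (fun t => (t 0)⁻¹) rB.domain ∧
        (4 : ℤ) • KZ.of rJ - (16 : ℤ) • KZ.of rI + (4 : ℤ) • KZ.of rU - (3 : ℤ) • KZ.of rP + c • KZ.of rB
          ∈ KZ.relations

/-- SUPPORT (M): dimension-2 product shadow `3•[rU] − 2•[rP]` of `u_P = ω₁/3` on the flex curve. -/
def FlexTorsionProduct : Prop :=
  ∀ (xP : ℝ), 2 < xP → 3 * xP ^ 4 - 42 * xP ^ 2 + 72 * xP - 49 = 0 →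
    ∀ (rP : KZ.IntegralRep 2), rP.domain = {z | 2 < z 0 ∧ 2 < z 1} →
      Set.EqOn rP.integrand (fun z => (Real.sqrt (4 * (z 0) ^ 3 - 28 * z 0 + 24))⁻¹ *
        ((28 * z 1 - 48) / (2 * (z 1) ^ 2 * Real.sqrt (4 * (z 1) ^ 3 - 28 * z 1 + 24)))) rP.domain →
      ∃ rU : KZ.IntegralRep 2, rU.domain = {z | xP < z 0 ∧ 2 < z 1} ∧
        Set.EqOn rU.integrand (fun z => (Real.sqrt (4 * (z 0) ^ 3 - 28 * z 0 + 24))⁻¹ *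
          ((28 * z 1 - 48) / (2 * (z 1) ^ 2 * Real.sqrt (4 * (z 1) ^ 3 - 28 * z 1 + 24)))) rU.domain ∧
        (3 : ℤ) • KZ.of rU - (2 : ℤ) • KZ.of rP ∈ KZ.relations

/-- RUNG stub (registered obligation). -/
theorem stub_neronDuplicationChain : NeronDuplicationChain := by
  sorry

/-- SUPPORT stub (registered obligation). -/
theorem stub_flexTorsionProduct : FlexTorsionProduct := by
  sorry

/-- COMPOSITION (proved): rung + flex product shadow ⟹ `TorsionLogs.NeronTorsionFlex`. -/
theorem NeronTorsionFlex_of_stubs (hdup : NeronDuplicationChain) (hprod : FlexTorsionProduct) :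
    Summit.KontsevichZagierPeriods.KontsevichZagierPeriods.Theses.TorsionLogs.NeronTorsionFlex := by
  intro xP hxP hψ rI rP rL hIdom hIint hPdom hPint hLdom hLint
  -- the flex curve `f(x) = 4x³ − 28x + 24 = 4(x−2)(x−1)(x+3)`
  have hpos : ∀ x : ℝ, 2 < x → 0 < 4 * x ^ 3 - 28 * x + 24 := by
    intro x hx
    have h : 4 * x ^ 3 - 28 * x + 24 = 4 * ((x - 2) * (x - 1) * (x + 3)) := by ring
    rw [h]
    have h1 : 0 < x - 2 := sub_pos.2 hx
    have h2 : 0 < x - 1 := by linarith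
    have h3 : 0 < x + 3 := by linarith
    positivity
  have hfP : 0 < 4 * xP ^ 3 - 28 * xP + 24 := hpos xP hxP
  -- `x_{2P} = x_P` at the flex: `(12x² − 28)² = 48·x·f(x)` is `16·ψ₃(x) = 0`
  have hxR : xP = (12 * xP ^ 2 - 28) ^ 2 / (16 * (4 * xP ^ 3 - 28 * xP + 24)) - 2 * xP := by
    rw [eq_sub_iff_add_eq, eq_div_iff (by positivity)]
    linear_combination 16 * hψ
  -- the flex root satisfies `x_P ≥ 5/2`, hence `f(x_P) ≥ 12` and `f(x_P)² ≥ 125`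
  have ht : 1 / 2 ≤ xP - 2 := by
    by_contra h
    push_neg at h
    have h0 : 0 < xP - 2 := sub_pos.2 hxP
    have h1 : (xP - 2) ^ 2 < 1 / 4 := by nlinarith
    have h2 : (xP - 2) ^ 3 < 1 / 8 := by nlinarith
    have h3 : (xP - 2) ^ 4 < 1 / 16 := by nlinarith
    have hφ : 3 * (xP - 2) ^ 4 + 24 * (xP - 2) ^ 3 + 30 * (xP - 2) ^ 2 - 25 = 0 := by
      have : 3 * (xP - 2) ^ 4 + 24 * (xP - 2) ^ 3 + 30 * (xP - 2) ^ 2 - 25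
          = 3 * xP ^ 4 - 42 * xP ^ 2 + 72 * xP - 49 := by ring
      rw [this, hψ]
    linarith
  have hf12 : 12 ≤ 4 * xP ^ 3 - 28 * xP + 24 := by
    have h0 : 0 < xP - 2 := sub_pos.2 hxP
    have : 4 * xP ^ 3 - 28 * xP + 24 = 20 * (xP - 2) + 24 * (xP - 2) ^ 2 + 4 * (xP - 2) ^ 3 := by ring
    rw [this]; nlinarith
  have hsq : (1 : ℝ) ≤ (4 * xP ^ 3 - 28 * xP + 24) ^ 2 / 125 := by
    rw [le_div_iff₀ (by norm_num : (0:ℝ) < 125)]; nlinarith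
  -- integrand conversions (`28·x′ − 48 = g₂·x′ + 2·g₃` with `g₂ = 28`, `g₃ = −24`)
  have hconv : (fun z : Fin 2 → ℝ => (Real.sqrt (4 * (z 0) ^ 3 - 28 * z 0 + 24))⁻¹ *
        ((28 * z 1 - 48) / (2 * (z 1) ^ 2 * Real.sqrt (4 * (z 1) ^ 3 - 28 * z 1 + 24))))
      = (fun z : Fin 2 → ℝ => (Real.sqrt ((fun x : ℝ => 4 * x ^ 3 - 28 * x + 24) (z 0)))⁻¹ *
        (((28 : ℝ) * z 1 + 2 * (-24)) / (2 * (z 1) ^ 2 *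
          Real.sqrt ((fun x : ℝ => 4 * x ^ 3 - 28 * x + 24) (z 1))))) := by
    funext z; norm_num [sub_eq_add_neg]
  obtain ⟨rU, hUdom, hUint, hUV⟩ := hprod xP hxP hψ rP hPdom hPint
  have hPint' := hPint
  have hUint' := hUint
  rw [hconv] at hPint' hUint'
  -- the rung at the flex point, with `x_R = x_P` and `rJ := rI`
  obtain ⟨c, B, rB, hB1, hBalg, hBc, hBdom, hBint, hchain⟩ :=
    hdup 28 (-24) 2 xP xP (fun x => 4 * x ^ 3 - 28 * x + 24) (fun x => by ring) (by norm_num)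
      (by norm_num) (by norm_num) hpos hxP hxR hxP rI rI rU rP hIdom hIint hIdom hIint hUdom hUint'
      hPdom hPint'
  have hBc' : B ^ c = (4 * xP ^ 3 - 28 * xP + 24) ^ 2 / 125 := by
    rw [hBc]; norm_num
  have hB0 : 0 < B := one_pos.trans hB1
  -- interval-log relation: `c•[log B] − [log (f(x_P)²/125)] ∈ relations`
  have hlog : c • KZ.of rB + (-1 : ℤ) • KZ.of rL ∈ KZ.relations := by
    have h := interval_log_relation_mem_relations 2 ![1, 1] ![B, (4 * xP ^ 3 - 28 * xP + 24) ^ 2 / 125]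
      ![c, -1] ![rB, rL] ?_ ?_ ?_ ?_ ?_ ?_
    · simpa [Fin.sum_univ_two] using h
    · intro i; fin_cases i <;> simp
    · intro i; fin_cases i
      · simpa using hB1.le
      · simpa using hsq
    · intro i; fin_cases i <;> simpa using isAlgebraic_one
    · intro i; fin_cases i
      · simpa using hBalg
      · simp only [Fin.mk_one, Matrix.cons_val_one, Matrix.head_cons]
        rw [← hBc']
        rcases c with (n | n)
        · simpa using IsAlgebraic.pow hBalg n
        · rw [zpow_negSucc]; exact (IsAlgebraic.pow hBalg (n + 1)).inv
    · intro i; fin_cases i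
      · exact ⟨hBdom, fun z hz => (hBint hz).trans (one_div (z 0)).symm⟩
      · exact ⟨hLdom, fun z hz => (hLint hz).trans (one_div (z 0)).symm⟩
    · simp only [Fin.sum_univ_two, Matrix.cons_val_zero, Matrix.cons_val_one, Matrix.head_cons,
        div_one, Int.cast_neg, Int.cast_one]
      rw [← hBc', Real.log_zpow]
      ring
  -- assemble: `36•[rI] + [rP] − 3•[rL] = −3·(rung) + 4·(product) + 3·(log relation)`
  have key : (36 : ℤ) • KZ.of rI + KZ.of rP - (3 : ℤ) • KZ.of rL
      = (-3 : ℤ) • ((4 : ℤ) • KZ.of rI - (16 : ℤ) • KZ.of rI + (4 : ℤ) • KZ.of rU - (3 : ℤ) • KZ.of rP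
          + c • KZ.of rB)
        + (4 : ℤ) • ((3 : ℤ) • KZ.of rU - (2 : ℤ) • KZ.of rP)
        + (3 : ℤ) • (c • KZ.of rB + (-1 : ℤ) • KZ.of rL) := by
    module
  rw [key]
  exact KZ.relations.add_mem (KZ.relations.add_mem (KZ.relations.zsmul_mem hchain _)
    (KZ.relations.zsmul_mem hUV _)) (KZ.relations.zsmul_mem hlog _)


/-- **The crux `TorsionLogs.NeronTorsionFlex`, by name, from the two registered stubs.** -/
theorem NeronTorsionFlex_of :
    Summit.KontsevichZagierPeriods.KontsevichZagierPeriods.Theses.TorsionLogs.NeronTorsionFlex :=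
  NeronTorsionFlex_of_stubs stub_neronDuplicationChain stub_flexTorsionProduct

end Summit.KontsevichZagierPeriods.KontsevichZagierPeriods.Cruxes.NeronTorsionFlex.NeronDuplication
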